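import Mathlib
import HarnessLib
import HarnessLib.Audit
import Summits.SmoothPoincare4.Statement
import Literature.Topology.FourManifolds.ConnectedSum
import Literature.Topology.FourManifolds.ComplexProjectiveSpace
import Literature.Topology.FourManifolds.OrientationSign
import Literature.Geometry.Lorentzian.PseudoRiemannianMetric
import Literature.Geometry.Lorentzian.LeviCivita
import Literature.Geometry.Riemannian.IsotropicCurvature
import Literature.Geometry.Riemannian.CurvatureDecomposition
import HarnessLib.Audit.Status.Attr

/-!
Route: TwistorDissolution

DORMANT since 2026-08-23T02:03:04Z (reconciler: no traction for 5.9 d (last activity item-evidence-added at 2026-08-17T05:02:26Z); parked, not closed — `ledger route dormant route-SmoothPoincare4-TwistorDissolution --off` to reactivate) — unstaffed, not closed; items shared with open routes are served there. `ledger route dormant <id> --off` reactivates.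

# Route TwistorDissolution — Blow up until self-dual — SPC4 from positive-type half-conformally-flat
metrics on Σ

It suffices to show X = SelfDualBlowUp ∧ CP2Cancellation. SelfDualBlowUp (EX≤4): every homotopy
4-sphere Σ has an iterated
connected sum P_n = Σ # CP² # ⋯ # CP² with n ≤ 4 projective planes (a chain P₀ ≅ Σ, P_{i+1} = P_i #
CP² in the tree's orientation-free
`IsConnectedSum`) carrying a Riemannian metric of positive scalar curvature which is half
conformally flat — Hamilton's curvature block C
is a scalar matrix in every positively oriented orthonormal frame of some smooth orientation, i.e.
W⁻ ≡ 0, an integrable twistor space.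
CP2Cancellation (CANCEL≤4): if such a P_n is diffeomorphic to the end Q_n of a chain of the same
length started at S⁴, then Σ ≅ S⁴.
The bridge 'EX ⇒ P_n ≅ Q_n' is a THEOREM at signature ≤ 4 — Pedersen–Poon 1994 Cor. 2.1: a compact
simply connected self-dual
4-manifold of positive type with τ ≤ 4 is DIFFEOMORPHIC to τCP² (real degree-2 divisors on the
twistor space exist because
h⁰(Z, K^{-1/2}) ≥ 2(5 − τ) > 0) — filed as the rank-2 crux PedersenPoonRigidity because it is not
yet a Literature fact. Realises card
twistor-moishezon-dissolution in the sharpened form its triage recommended (level ≤ 4 needs no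
Moishezon hypothesis); the card's general-n
version (Taubes' self-dual metrics on Σ̄ # nCP² for n ≫ 0 + 'Moishezon / degree-2 divisor ⇒
diffeomorphic to nCP²', Pedersen 1995
Remark 2, open) is the recorded pivot.
Lean: `SelfDualBlowUp ∧ CP2Cancellation`

## Assembly
Pure logic, no tree facts at all (deciding theorem `closes`, rev 2; theorem assembly_holds in the
repair planner's Sketch.lean, axioms
propext / Classical.choice / Quot.sound): for a homotopy 4-sphere M (Hausdorff, second countable,
smooth, e : M ≃ₕ S⁴ — the items are
stated over this bare M since the 2026-08-15 cone repair, not over `HomotopySphere 4`),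
SelfDualBlowUp gives n ≤ 4, the chain P with
P₀ ≃ₘ M and the metric; PedersenPoonRigidity gives the standard chain Q from S⁴ with P_n ≃ₘ Q_n;
CP2Cancellation gives M ≃ₘ S⁴, which is
SmoothPoincare4 unfolded (HomotopyEquiv.NonemptyDiffeomorphSphere M 4). Compactness and
orientability of M are consequences (proved tree
facts compactSpace_/isOrientable_of_homotopyEquiv_sphere_four) and are deliberately not hypotheses,
so the route imports neither
HomotopySpheres.lean nor the packaging proof files.

Rationale: WHY THIS LINE. Penrose–Atiyah–Hitchin–Singer: W⁻ = 0 makes the twistor space Z of (M, [g]) a compact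
complex threefold, and when the conformal class has
positive Yamabe type the algebraic geometry of Z (Hitchin vanishing, Riemann–Roch χ(K^{-1/2}) = 2(5
− τ), a real degree-2 divisor is a
blown-up quadric swept by twistor lines) reads off a DIFFEOMORPHISM M ≅ τCP² (PedersenPoon1994 =
doi:10.2307/2160286; exposition
Pedersen2017 Thm 2.1 / Cor 2.1, read) — the one printed place where the smooth type of a 4-manifold
homeomorphic to nCP² is decided by
complex-algebraic geometry, beyond the Donaldson+Freedman homeomorphism that b⁻ = 0 (LeBrun1986,
Hitchin1981) alone gives. A homotopy
sphere carries no such metric unless it is S⁴ (τ = 0 forces W ≡ 0; Kuiper1949, PROVED in tree, route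
PIC's LCF crux), so the price is
blow-ups: Σ # nCP² is homeomorphic to nCP², where positive-type self-dual classes abound (Poon1986 n
= 2; LeBrun1991 / LeBrun2017
hyperbolic ansatz, all n; Floer1991; DonaldsonFriedman1989; unobstructed moduli of dimension 7n −
15), and Taubes1992 proves self-dual
metrics exist on M̄ # nCP² for EVERY closed M once n ≫ 0. SPC4 becomes an elliptic EXISTENCE problem
(W⁻ = 0, Yamabe-positive) on a fixed
closed manifold homeomorphic to 4CP² with a 13-dimensional target moduli space, plus a
CP²-cancellation statement of Kirby-4.23 type
(Kirby1997; ManolescuMarengonSarkarWillis2023 Q9.12 for the dissolution side). Imported: twistor /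
complex-algebraic geometry (rigidity),
nonlinear elliptic gluing (existence), embedded-surface 4-topology (cancellation); no spectral or
probabilistic reformulation. What
prior routes do not do: PIC and WeylBudget ask for curvature conditions on Σ itself, where only the
round metric qualifies in the limit;
Stabilisation uses S²×S², for which no curvature recogniser exists; here the stabiliser CP² is the
one summand for which an existence
engine (Taubes) and a recognition theorem (Pedersen–Poon) are both in print. Negatives index empty
at filing.

RANKED CRUXES. #0 TwistorDissolutionThesis (target) — X = SelfDualBlowUp ∧ CP2Cancellation
(existence of positive-type half-conformally-flat metrics after ≤ 4 blow-ups, and cancellation of ≤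
4 projective planes off a homotopy sphere). (why it might fail: both conjuncts are SPC4-hard: mod
PedersenPoon1994 + LeBrun1991, EX≤4 ⇔ 'Σ # nCP² ≅ nCP² for some n ≤ 4' (MMSW Q9.12, open even for
the D(P) family), and CANCEL≤4 contains smooth Kirby Problem 4.23.) [PedersenPoon1994,
ManolescuMarengonSarkarWillis2023, Kirby1997]
#2 PedersenPoonRigidity (crux) — KNOWN THEOREM filed as the first crux because it is not yet a
Literature fact (card item T-RIG at level ≤ 4). For a homotopy 4-sphere Σ, n ≤ 4 and a chain of
closed smooth 4-manifolds P₀ ≅ Σ, P_{i+1} = P_i # CP² (i < n; the tree's orientation-free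
IsConnectedSum with Literature ComplexProjectivePlane): if P_n carries a smooth orientation o and a
Riemannian metric g (with its Levi-Civita connection) of everywhere positive scalar curvature whose
Hamilton block C (the Λ⁻Λ⁻ block of CurvatureDecomposition.lean) is a scalar matrix in every
o-positive g-orthonormal frame — W⁻ ≡ 0, self-dual of positive type — then P_n is diffeomorphic to
the end Q_n of a chain Q₀ ≅ S⁴, Q_{i+1} = Q_i # CP² of the same length. This is PedersenPoon1994 Thm
2.1 + Cor 2.1 (τ ≤ 4 ⇒ h⁰(Z, K^{-1/2}) ≥ 2(5 − τ) > 0 ⇒ a real degree-2 divisor ⇒ M ≅ τCP²;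
Pedersen2017 pp. 134–136 read) together with b⁻ = 0 for positive-type self-dual metrics (LeBrun1986
/ Hitchin's Weitzenböck formula, so τ = b₂(P_n) = n and mixed-orientation chains carry no such
metric) and, at n = 0, Kuiper (tree: kuiper_conformallyFlat_sphere_four_holds). Expected discharge:
vend the cite fact (filed) and restate with it as hypothesis, or prove. [difficulty: XL] (why it
might fail: Transcription, not mathematics: the frame-wise clause (block C scalar in o-positive
orthonormal frames) over orientation-free sums must match PP's 'oriented self-dual of positive
type'; τ = n needs b⁻ = 0 (LeBrun1986); the 5-page PAMS proof leans on Poon's divisor theory.)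
[PedersenPoon1994, doi:10.2307/2160286, Pedersen2017, LeBrun1986, Poon1986, Hitchin1981, Kuiper1949]
#3 SelfDualBlowUp (crux) — (EX≤4; card item T-ALG at level ≤ 4) for every homotopy 4-sphere Σ there
are n ≤ 4 and a chain of closed smooth 4-manifolds P₀ ≅ Σ, P_{i+1} = P_i # CP² (i < n) such that P_n
admits a smooth orientation o and a Riemannian metric g with Levi-Civita connection, scal_g > 0
everywhere, and Hamilton's block C(g) a scalar matrix in every o-positive g-orthonormal frame (half
conformally flat, W⁻ ≡ 0: the twistor space of (P_n, o, [g]) is a compact complex threefold).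
Consistency: SPC4 ⇒ EX≤4 with n = 4 by LeBrun's explicit positive-type self-dual metrics on 4CP²;
conversely EX≤4 + PedersenPoonRigidity give CP²-dissolution at level ≤ 4. [difficulty: open-problem]
(why it might fail: Only Taubes1992 builds SD metrics on an unknown Σ̄ # nCP², with n ≫ 0
uncontrolled ('no reasonable estimate', LeBrun2017 p.82) and no Yamabe sign; symmetric ansätze force
standardness (Fintushel–Pao); mod PP it is CP²-dissolution at level ≤ 4 (MMSW Q9.12), open.)
[Taubes1992, LeBrun2017, LeBrun1991, Poon1986, DonaldsonFriedman1989, Floer1991, Kalafat2011,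
ManolescuMarengonSarkarWillis2023, Fintushel1978]
#4 CP2Cancellation (crux) — (CANCEL≤4; card item CANCELₙ) for a homotopy 4-sphere Σ, n ≤ 4, a chain
P₀ ≅ Σ, P_{i+1} = P_i # CP² and a chain Q₀ ≅ S⁴, Q_{i+1} = Q_i # CP² (i < n) of closed smooth
4-manifolds: P_n ≅ Q_n ⇒ Σ ≅ S⁴. At n = 1 this is Melvin's form of the smooth Kirby Problem 4.23 (a
degree-one 2-sphere in CP² with simply connected complement is standard;
book:gordon1984-four-manifold-theory p.465); the tree's IsConnectedSum being orientation-free, mixed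
patterns Σ # kCP² # lCP²bar are included — every case follows from SPC4, and the assembly consumes
only the pattern SelfDualBlowUp produces. [difficulty: open-problem] (why it might fail: It is SPC4
for CP²-dissolvable spheres ⊇ all Gluck twists (Σ_K # CP² ≅ CP², tree fact
gluckTwist_connectedSum_complexProjectivePlane_holds): one exotic Gluck twist kills it, and the
light-bulb isotopy engine stops at odd-Euler duals (Gabai arXiv:1705.09989 Lem 2.3).) [Kirby1997,
book:gordon1984-four-manifold-theory, arXiv:1705.09989, GompfStipsicz1999,
ManolescuMarengonSarkarWillis2023]
#9 DissolveOfSelfDual (support) — glue, provable now (theorem dissolveOfSelfDual_holds in the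
planner's Sketch.lean, sorry-free): PedersenPoonRigidity → SelfDualBlowUp → DISSOLVE≤4 (every
homotopy 4-sphere has n ≤ 4 and chains P from Σ, Q from S⁴ of n projective planes with P_n ≅ Q_n).
Materialises the CP²-dissolution statement (the shape of ManolescuMarengonSarkarWillis2023 Question
9.12) as a decl that other cards (odd-light-bulb-cp2, cp2-split-taubes-dissolution) can want.
[difficulty: provable-now] [PedersenPoon1994, ManolescuMarengonSarkarWillis2023]

TWO-LAYER PLAN. Foreseen glued splits, none filed now (k ≤ 3, depth 1). SelfDualBlowUp ⇐
SdBlowUpSomeLevel (∀ Σ ∃ n, a chain of length n with a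
positive-type half-conformally-flat metric on P_n: Taubes-level existence WITH Yamabe positivity,
e.g. grafting from a PSC metric on Σ —
route PIC's PicPsc / WeylBudget's cruxes — keeping s > 0, cf. Kalafat2011) → BubbleCount (for
homotopy spheres four bubbles suffice: a
quantitative Taubes theorem bounding the obstruction space of the self-dual deformation complex on
Σ̄ # nCP²) → SelfDualBlowUp.
CP2Cancellation ⇐ UnknotDegreeOneConfiguration (n ≤ 4 pairwise disjoint (+1)-spheres with simply
connected complement in a manifold
diffeomorphic to an n-fold CP²-sum of S⁴ are standard) → MelvinDictionary (complement bookkeeping +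
Γ₄ = 0, Cerf) → CP2Cancellation.
PedersenPoonRigidity ⇐ (Literature named fact for PedersenPoon1994 Thm 2.1/Cor 2.1, cite item filed)
→ (b⁻ = 0 and chain/Betti
bookkeeping, LeBrun1986) → PedersenPoonRigidity.

KILL CRITERIA. SelfDualBlowUp or CP2Cancellation refuted for an explicit Σ exhibits an exotic
4-sphere (both are consequences of SPC4 given LeBrun1991 and
PedersenPoon1994): the route closes with the problem. A refutation of PedersenPoonRigidity AS STATED
(frame clause or orientation
bookkeeping wrong) forces `--restate`, not closure; a genuine counterexample to Pedersen–Poon Cor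
2.1 would be an exotic nCP² (n ≤ 4)
detected by twistor theory — close `refuted:PedersenPoonRigidity`. Soft kill of the MECHANISM: a
theorem that every symmetry-free
self-dual existence method applicable to an abstract Σ̄ # nCP² needs n ≥ 5 (Taubes' bubble count) or
cannot reach positive type — pivot by
`--restate SelfDualBlowUp` to general n with the extra hypothesis 'the twistor space carries a real
degree-2 divisor' (PedersenPoon1994
Thm 2.1 holds for all τ) once twistor vocabulary exists, or to the card's Moishezon form (open:
Pedersen2017 Remark 2,
CampanaKreussler1998). SPC4 proved elsewhere moots everything; DISSOLVE≤4 proved elsewhere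
(cork/plug calculus) moots SelfDualBlowUp
and leaves CP2Cancellation, shared in substance with card odd-light-bulb-cp2.

NOT DECOMPOSED YET. The analytic route to SelfDualBlowUp (Taubes grafting with a bubble count;
Donaldson–Friedman / Floer gluing of twistor spaces;
Kovalev–Singer) — layer-2 children once PedersenPoonRigidity is vended; the Yamabe-positivity
mechanism (Kalafat2011: positive type
survives Donaldson–Friedman sums); the general-n twistor vocabulary (twistor space of a
half-conformally-flat 4-manifold as a complex
threefold, real degree-d divisors, algebraic dimension / Moishezon) — definition requests deferred
to the pivot; the card's negative
companion 'sup over self-dual classes of a(Z(Σ̄ # nCP²)) < 3' — untypable today; oriented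
bookkeeping (IsOrientedConnectedSum exists in
the tree, but the cruxes are stated orientation-free like the barrier file's dissolution fact, and
positive type forces b⁻ = 0 anyway).

CHEAPEST FALSIFIER. (i) Lookup, done this session and negative: is 'positive-type self-dual + simply
connected ⇒ DIFFEOMORPHIC to nCP²' meanwhile known for
all n (would lift the level restriction) or refuted (an exotic nCP² with a PSC self-dual metric)?
Pedersen2017 Remark 2 poses it as open;
nothing newer found (Kalafat2011, Honda–Kreußler 2017 stay on the standard nCP²; OpenAlex/arXiv APIs
were rate-limited, so a 2018–2026
check is owed by the refuter). (ii) Cheapest kill of the existence MECHANISM: read Taubes1992's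
constants for M = S⁴ with a NON-round
metric — if even a metrically perturbed standard sphere needs ≥ 5 grafted CP²'s before the
implicit-function step closes, EX≤4 has no
engine for unknown Σ and the route must pivot to general n at once. (iii) Any exotic Gluck twist
kills CP2Cancellation immediately
(Σ_K # CP² ≅ CP² is a tree fact).

NUMBERS. χ(Z, K^{-1/2}) = 2(5 − τ) for the twistor space of a positive-type self-dual manifold
homeomorphic to τCP², with h² = h³ = 0 (Hitchin
vanishing + Serre duality), hence real degree-2 divisors for τ ≤ 4 and no free divisor for τ ≥ 5
(Pedersen2017 p.135); expected
dimension of the self-dual moduli space on nCP²: 7n − 15 for n ≥ 3 (13 at n = 4), versus the rigid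
cases n = 0, 1 (S⁴, CP²: Kuiper1949,
Poon1986); Taubes1992: m ≫ 0 with 'no reasonable estimate of how large m needs to be' (LeBrun2017
p.82), while m = 14 suffices for
M = CP² by explicit construction (ibid.); signature formula 12π²τ = ∫(‖W⁺‖² − ‖W⁻‖²). Items at open:
6 (1 target, 3 cruxes, 1 support,
1 assembly).

DEFINITION REQUESTS. (1) `IsSelfDualWith (o : SmoothOrientation (𝓡 4) M) (g : PseudoRiemannianMetric
…)` / `IsHalfConformallyFlat g` in
Literature/Geometry/Riemannian over blockA/blockC of CurvatureDecomposition.lean and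
SmoothOrientation.IsPosFrame, with the
frame-independence and orientation-reversal (A ↔ C) lemmas — to replace the inline clause used in
PedersenPoonRigidity and SelfDualBlowUp
(filed with `ledger workitem add --kind definition`). (2) Cite fact wanted: PedersenPoon1994 Thm 2.1
+ Cor 2.1 with LeBrun1986 (b⁻ = 0) in
the chain form used verbatim as PedersenPoonRigidity (filed as a cite item). (3) Deferred to the
pivot: `twistorSpace` (AHS) of a
half-conformally-flat (M, o, [g]) as a complex 3-manifold; real degree-d divisors;
`algebraicDimension` / `IsMoishezon`.

Novelty: Searches (2026-08-15): `lit galaxy read panama:215555818651668` (Huggett ed., Twistor Theory): ch.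
10 Pedersen pp. 133–137 and ch. 7
LeBrun pp. 81–86 READ; `lit galaxy search --star panama --in-book 215555818651668 "Taubes"` (1);
`lit search --source zbmath "Pedersen
Poon self-duality differentiable structures"` (1: doi:10.2307/2160286, review read; `lit read` of
the PAMS pdf → 429, acq-02338 filed);
`lit search --source crossref` ×8 ("LeBrun explicit self-dual metrics" 10, "Kalafat self-dual
positive scalar curvature" 9, "Taubes
existence anti-self-dual" 5, "Pedersen self-duality connected sums" 5, "LeBrun topology self-dual
1986" 5, "Donaldson Friedman connected
sums self-dual" 4, "Poon algebraic dimension twistor" 5, "Campana twistor class C" 4); `lit read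
arxiv:1910.08195 --grep 'Question
9.1'` (Q9.11/Q9.12, p.30 read); `lit read book:gordon1984-four-manifold-theory --grep 'Problem
4.23'` (p.465 read); zbMATH free-text,
OpenAlex and arXiv APIs rate-limited (429) and the local searchd reset this session; all 13 Theses
of the sub, the sibling cards
(odd-light-bulb-cp2 open/variant; cp2-split-taubes-dissolution, definite-connections-twistor-fano,
dissolve-then-descend-cp2 retired)
and `ledger negatives` (0) read.
Nearest prior art found: PedersenPoon1994 / Pedersen2017 (the rigidity theorem at τ ≤ 4 and the open
Moishezon question, Remark 2);
Taubes1992 with LeBrun2017 (existence for n ≫ 0, no estimate); ManolescuMarengonSarkarWillis2023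
Question 9.12 (CP²-dissolution of D(P  [refs: 10.2307/2160286, 1910.08195, doi:10.2307/2160286, arxiv:1910.08195, book:gordon1984-four-manifold-theory, PedersenPoon1994, Pedersen2017, Taubes1992, LeBrun2017, ManolescuMarengonSarkarWillis2023]

Barriers (technique_class: self-dual-blow-up, twistor-rigidity, CP2-cancellation): - technique_class: self-dual-blow-up, twistor-rigidity, CP2-cancellation
- Literature.Barriers.SmoothPoincare4.GluckTwistCP2Barrier: respected and used positively — the
barrier says CP²-cancellative INVARIANTS cannot detect exotic Gluck twists; this line proves
standardness THROUGH CP²-stabilisation (EX gives dissolution, CANCEL undoes it) and evaluates no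
invariant of Σ # nCP²; conceded: for Gluck twists EX holds trivially (Σ_K # CP² ≅ CP² carries
Fubini–Study), so for that family all difficulty sits in CP2Cancellation, exactly where the barrier
says invariants are blind.
- Literature.Barriers.SmoothPoincare4.CircleActionBarrierFour: bites on the existence MECHANISM —
every explicit positive-type self-dual metric known (LeBrun1991, Joyce, Honda) has S¹- or
T²-symmetry, and a homotopy-sphere summand with a circle action is standard (Fintushel–Pao), so
SelfDualBlowUp for an unknown Σ needs a symmetry-free engine (Taubes1992 grafting,
DonaldsonFriedman1989 / Floer1991 gluing); the bet is a quantitative Taubes theorem, not an ansatz.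
- Literature.Barriers.SmoothPoincare4.TopologicalBarrierFour: evaded — Pedersen–Poon's output is a
diffeomorphism read off a ruled complex surface inside the twistor space, strictly beyond the
Donaldson+Freedman homeomorphism that b⁻ = 0 alone gives (Campana1991, Poon1988 for the Moishezon
variant).
- Literature.Barriers.SmoothPoincare4.HCobordismInvariantBarrierFour: not engaged — no h-cobordism
invariant is evaluated (Σ # nCP² is h-cobordant to nC

History (route lifecycle, newest last):
- 2026-08-15T16:52:47Z · rev 2: restated TwistorDissolutionThesis (stmt-SmoothPoincare4-7197), PedersenPoonRigidity (stmt-SmoothPoincare4-7198), SelfDualBlowUp (stmt-SmoothPoincare4-7199), CP2Cancellation (stmt-SmoothPoincare4-7200), DissolveOfSelfDual (stmt-SmoothPoincare4-7201) — cone repair (rrepair unit): restate target + 3 cruxes + suppor (planner-rrepair-SmoothPoincare4-TwistorDissolu-32a67a82-0)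
- 2026-08-23T02:03:04Z · DORMANT — reconciler: no traction for 5.9 d (last activity item-evidence-added at 2026-08-17T05:02:26Z); parked, not closed — `ledger route dormant route-SmoothPoincare4- (operator:999:2491073)

sub-problem: SmoothPoincare4 · status: dormant · opened planner-plancard-SmoothPoincare4-SmoothPoinca-dcf211e1-0 2026-08-15T12:05:00Z · rev 6 · ledger route-SmoothPoincare4-TwistorDissolution
GENERATED by the gate from the ledger (D-0016/17). Provers cite these decls: `theorem foo : Summit.SmoothPoincare4.SmoothPoincare4.Theses.TwistorDissolution.<Decl> := …` in Summits/SmoothPoincare4/SmoothPoincare4/Theorems/<Name>.lean.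
-/

namespace Summit.SmoothPoincare4.SmoothPoincare4.Theses.TwistorDissolution

open scoped BigOperators Topology Manifold Classical MeasureTheory ProbabilityTheory Matrix InnerProductSpace ComplexConjugate ContinuousMap ContDiff
open Filter Set Function TopologicalSpace MeasureTheory

attribute [summit_statement] _root_.SmoothPoincare4

open Literature.SPC4

-- earlier TwistorDissolutionThesis (stmt-SmoothPoincare4-7197, replaced 2026-08-15T16:52:47Z -> stmt-SmoothPoincare4-11123): retired by None — (∀ (S : Literature.Topology.FourManifolds.HomotopySphere 4), ∃ (n : ℕ) (_ : n ≤ 4) (P : ℕ → Type) (_ : ∀ i, TopologicalSpace (P i)) (_ : ∀ i, T2Space (P i)) (_ : ∀ i, SecondCountableTopology (P i)) (_ : ∀ i, ChartedSpace (EuclideanSpace ℝ (Fin 4)) (P i)) (_ :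
/-- item stmt-SmoothPoincare4-11123 · target · rank 0 · open · by planner
why it might fail: both conjuncts are SPC4-hard: mod PedersenPoon1994 + LeBrun1991, EX≤4 ⇔ 'Σ # nCP² ≅ nCP² for some n ≤ 4' (MMSW Q9.12, open even for the D(P) family), and CANCEL≤4 contains smooth Kirby Problem 4.23.
sources: PedersenPoon1994, ManolescuMarengonSarkarWillis2023, Kirby1997
X = SelfDualBlowUp ∧ CP2Cancellation, written out in full (the target is rendered before the cruxes,
so it cannot name them; `TwistorDissolutionThesis ↔ SelfDualBlowUp ∧ CP2Cancellation` is Iff.rfl):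
existence of positive-type half-conformally-flat metrics after ≤ 4 blow-ups of a homotopy 4-sphere
M, and cancellation of ≤ 4 projective planes off M. [restated 2026-08-15 cone-repair: quantified
over a bare homotopy 4-sphere M — Hausdorff, second countable, smooth, Nonempty (M ≃ₕ S⁴) — instead
of the packaging structure `HomotopySphere 4`, so the route no longer imports
Literature.Topology.FourManifolds.HomotopySpheres (+ Cobordism) and their undischarged facts;
mathematically identical (compactness/orientability of M are proved tree facts and are not
hypotheses here).] -/
@[route_item "route-SmoothPoincare4-TwistorDissolution"]
def TwistorDissolutionThesis : Prop :=
  (∀ (M : Type) [TopologicalSpace M] [T2Space M] [SecondCountableTopology M] [ChartedSpace (EuclideanSpace ℝ (Fin 4)) M] [IsManifold (𝓡 4) ∞ M], Nonempty (M ≃ₕ (Metric.sphere (0 : EuclideanSpace ℝ (Fin 5)) 1)) → ∃ (n : ℕ) (_ : n ≤ 4) (P : ℕ → Type) (_ : ∀ i, TopologicalSpace (P i)) (_ : ∀ i, T2Space (P i)) (_ : ∀ i, SecondCountableTopology (P i)) (_ : ∀ i, ChartedSpace (EuclideanSpace ℝ (Fin 4)) (P i)) (_ : ∀ i, IsManifold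 (𝓡 4) ∞ (P i)) (_ : ∀ i, CompactSpace (P i)), Nonempty (P 0 ≃ₘ⟮𝓡 4, 𝓡 4⟯ M) ∧ (∀ i < n, Literature.Topology.FourManifolds.IsConnectedSum (𝓡 4) (𝓡 4) (𝓡 4) (P i) Literature.Topology.FourManifolds.ComplexProjectivePlane (P (i + 1))) ∧ ∃ (o : Literature.Topology.FourManifolds.SmoothOrientation (𝓡 4) (P n)) (g : Literature.Geometry.Lorentzian.PseudoRiemannianMetric (𝓡 4) ∞ (EuclideanSpace ℝ (Fin 4)) (TangentSpace (𝓡 4) : P n → Type _)) (_ : g.HasLeviCivita), g.IsRiemannian ∧ (∀ x, 0 < g.scalarCurvature x) ∧ ∀ (x : P n) (e : Fin 4 → TangentSpace (𝓡 4) x), g.IsOrthonormalFrame x e → o.IsPosFrame x (fun i => e (Fin.cast finrank_euclideanSpace_fin i)) → g.blockC g.leviCivita x e = ((g.blockC g.leviCivita x e).trace / 3) • (1 : Matrix (Fin 3) (Fin 3) ℝ)) ∧ (∀ (M : Type) [TopologicalSpace M] [T2Space M] [SecondCountableTopology M] [ChartedSpace (EuclideanSpace ℝ (Fin 4)) M]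 [IsManifold (𝓡 4) ∞ M], Nonempty (M ≃ₕ (Metric.sphere (0 : EuclideanSpace ℝ (Fin 5)) 1)) → ∀ (n : ℕ), n ≤ 4 → ∀ (P Q : ℕ → Type) [∀ i, TopologicalSpace (P i)] [∀ i, T2Space (P i)] [∀ i, SecondCountableTopology (P i)] [∀ i, ChartedSpace (EuclideanSpace ℝ (Fin 4)) (P i)] [∀ i, IsManifold (𝓡 4) ∞ (P i)] [∀ i, CompactSpace (P i)] [∀ i, TopologicalSpace (Q i)] [∀ i, T2Space (Q i)] [∀ i, SecondCountableTopology (Q i)] [∀ i, ChartedSpace (EuclideanSpace ℝ (Fin 4)) (Q i)] [∀ i, IsManifold (𝓡 4) ∞ (Q i)] [∀ i, CompactSpace (Q i)], Nonempty (P 0 ≃ₘ⟮𝓡 4, 𝓡 4⟯ M) → Nonempty (Q 0 ≃ₘ⟮𝓡 4, 𝓡 4⟯ (Metric.sphere (0 : EuclideanSpace ℝ (Fin 5)) 1)) → (∀ i < n, Literature.Topology.FourManifolds.IsConnectedSum (𝓡 4) (𝓡 4) (𝓡 4) (P i) Literature.Topology.FourManifolds.ComplexProjectivePlane (P (i + 1)))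 → (∀ i < n, Literature.Topology.FourManifolds.IsConnectedSum (𝓡 4) (𝓡 4) (𝓡 4) (Q i) Literature.Topology.FourManifolds.ComplexProjectivePlane (Q (i + 1))) → Nonempty (P n ≃ₘ⟮𝓡 4, 𝓡 4⟯ Q n) → Nonempty (M ≃ₘ⟮𝓡 4, 𝓡 4⟯ (Metric.sphere (0 : EuclideanSpace ℝ (Fin 5)) 1)))

-- earlier PedersenPoonRigidity (stmt-SmoothPoincare4-7198, replaced 2026-08-15T16:52:47Z -> stmt-SmoothPoincare4-11124): retired by None — ∀ (S : Literature.Topology.FourManifolds.HomotopySphere 4) (n : ℕ), n ≤ 4 → ∀ (P : ℕ → Type) [∀ i, TopologicalSpace (P i)] [∀ i, T2Space (P i)] [∀ i, SecondCountableTopology (P i)] [∀ i, ChartedSpace (EuclideanSpace ℝ (Fin 4)) (P i)] [∀ i, IsManifold (𝓡 4) ∞ (P i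
/-- item stmt-SmoothPoincare4-11124 · crux · rank 2 · open · by planner
why it might fail: Transcription, not mathematics: the frame-wise clause (block C scalar in o-positive orthonormal frames) over orientation-free sums must match PP's 'oriented self-dual of positive type'; τ = n needs b⁻ = 0 (LeBrun1986); the 5-page PAMS proof leans on Poon's divisor theory.
sources: PedersenPoon1994, doi:10.2307/2160286, Pedersen2017, LeBrun1986, Poon1986, Hitchin1981
KNOWN THEOREM filed as the first crux because it is not yet a Literature fact (card item T-RIG at
level ≤ 4). For a homotopy 4-sphere M (≃ₕ S⁴), n ≤ 4 and a chain of closed smooth 4-manifolds P₀ ≅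
M, P_{i+1} = P_i # CP² (i < n; the tree's orientation-free IsConnectedSum with Literature
ComplexProjectivePlane): if P_n carries a smooth orientation o and a Riemannian metric g (with its
Levi-Civita connection) of everywhere positive scalar curvature whose Hamilton block C (the Λ⁻Λ⁻
block of CurvatureDecomposition.lean) is a scalar matrix in every o-positive g-orthonormal frame —
W⁻ ≡ 0, self-dual of positive type — then P_n is diffeomorphic to the end Q_n of a chain Q₀ ≅ S⁴,
Q_{i+1} = Q_i # CP² of the same length. This is PedersenPoon1994 Thm 2.1 + Cor 2.1 (τ ≤ 4 ⇒ h⁰(Z,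
K^{-1/2}) ≥ 2(5 − τ) > 0 ⇒ a real degree-2 divisor ⇒ P_n ≅ τCP²; Pedersen2017 pp. 134–136 read)
together with b⁻ = 0 for positive-type self-dual metrics (LeBrun1986 / Hitchin's Weitzenböck
formula, so τ = b₂(P_n) = n and mixed-orientation chains carry no such metric) and, at n = 0, Kuiper
(tree: kuiper_conformallyFlat_sphere_four_holds). Expected discharge: vend the cite fact (filed) and
restate with it as hypothesis, -/
@[route_item "route-SmoothPoincare4-TwistorDissolution", crux]
def PedersenPoonRigidity : Prop :=
  ∀ (M : Type) [TopologicalSpace M] [T2Space M] [SecondCountableTopology M] [ChartedSpace (EuclideanSpace ℝ (Fin 4)) M] [IsManifold (𝓡 4) ∞ M], Nonempty (M ≃ₕ (Metric.sphere (0 : EuclideanSpace ℝ (Fin 5)) 1)) → ∀ (n : ℕ), n ≤ 4 → ∀ (P : ℕ → Type) [∀ i, TopologicalSpace (P i)] [∀ i, T2Space (P i)] [∀ i, SecondCountableTopology (P i)] [∀ i, ChartedSpace (EuclideanSpace ℝ (Fin 4)) (P i)] [∀ i, IsManifold (𝓡 4) ∞ (P i)] [∀ i, CompactSpace (P i)],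 Nonempty (P 0 ≃ₘ⟮𝓡 4, 𝓡 4⟯ M) → (∀ i < n, Literature.Topology.FourManifolds.IsConnectedSum (𝓡 4) (𝓡 4) (𝓡 4) (P i) Literature.Topology.FourManifolds.ComplexProjectivePlane (P (i + 1))) → (∃ (o : Literature.Topology.FourManifolds.SmoothOrientation (𝓡 4) (P n)) (g : Literature.Geometry.Lorentzian.PseudoRiemannianMetric (𝓡 4) ∞ (EuclideanSpace ℝ (Fin 4)) (TangentSpace (𝓡 4) : P n → Type _)) (_ : g.HasLeviCivita), g.IsRiemannian ∧ (∀ x, 0 < g.scalarCurvature x) ∧ ∀ (x : P n) (e : Fin 4 → TangentSpace (𝓡 4) x), g.IsOrthonormalFrame x e → o.IsPosFrame x (fun i => e (Fin.cast finrank_euclideanSpace_fin i)) → g.blockC g.leviCivita x e = ((g.blockC g.leviCivita x e).trace / 3) • (1 : Matrix (Fin 3) (Fin 3) ℝ)) → ∃ (Q : ℕ → Type) (_ : ∀ i, TopologicalSpace (Q i)) (_ : ∀ i, T2Space (Q i)) (_ : ∀ i, SecondCountableTopology (Q i)) (_ : ∀ i, ChartedSpace (EuclideanSpace ℝ (Fin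 4)) (Q i)) (_ : ∀ i, IsManifold (𝓡 4) ∞ (Q i)) (_ : ∀ i, CompactSpace (Q i)), Nonempty (Q 0 ≃ₘ⟮𝓡 4, 𝓡 4⟯ (Metric.sphere (0 : EuclideanSpace ℝ (Fin 5)) 1)) ∧ (∀ i < n, Literature.Topology.FourManifolds.IsConnectedSum (𝓡 4) (𝓡 4) (𝓡 4) (Q i) Literature.Topology.FourManifolds.ComplexProjectivePlane (Q (i + 1))) ∧ Nonempty (P n ≃ₘ⟮𝓡 4, 𝓡 4⟯ Q n)

-- earlier SelfDualBlowUp (stmt-SmoothPoincare4-7199, replaced 2026-08-15T16:52:47Z -> stmt-SmoothPoincare4-11125): retired by None — ∀ (S : Literature.Topology.FourManifolds.HomotopySphere 4), ∃ (n : ℕ) (_ : n ≤ 4) (P : ℕ → Type) (_ : ∀ i, TopologicalSpace (P i)) (_ : ∀ i, T2Space (P i)) (_ : ∀ i, SecondCountableTopology (P i)) (_ : ∀ i, ChartedSpace (EuclideanSpace ℝ (Fin 4)) (P i)) (_ : ∀ i, IsMan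
/-- item stmt-SmoothPoincare4-11125 · crux · rank 3 · open · by planner
why it might fail: Only Taubes1992 builds SD metrics on an unknown Σ̄ # nCP², with n ≫ 0 uncontrolled ('no reasonable estimate', LeBrun2017 p.82) and no Yamabe sign; symmetric ansätze force standardness (Fintushel–Pao); mod PP it is CP²-dissolution at level ≤ 4 (MMSW Q9.12), open.
sources: Taubes1992, LeBrun2017, LeBrun1991, Poon1986, DonaldsonFriedman1989, Floer1991
(EX≤4; card item T-ALG at level ≤ 4) for every homotopy 4-sphere M (smooth, Hausdorff, second
countable, M ≃ₕ S⁴) there are n ≤ 4 and a chain of closed smooth 4-manifolds P₀ ≅ M, P_{i+1} = P_i #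
CP² (i < n) such that P_n admits a smooth orientation o and a Riemannian metric g with Levi-Civita
connection, scal_g > 0 everywhere, and Hamilton's block C(g) a scalar matrix in every o-positive
g-orthonormal frame (half conformally flat, W⁻ ≡ 0: the twistor space of (P_n, o, [g]) is a compact
complex threefold). Consistency: SPC4 ⇒ EX≤4 with n = 4 by LeBrun's explicit positive-type self-dual
metrics on 4CP²; conversely EX≤4 + PedersenPoonRigidity give CP²-dissolution at level ≤ 4.
[difficulty: open-problem] [restated 2026-08-15 cone-repair: quantified over a bare homotopy
4-sphere M — Hausdorff, second countable, smooth, Nonempty (M ≃ₕ S⁴) — instead of the packaging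
structure `HomotopySphere 4`, so the route no longer imports
Literature.Topology.FourManifolds.HomotopySpheres (+ Cobordism) and their undischarged facts;
mathematically identical (compactness/orientability of M are proved tree facts and are not
hypotheses here).] -/
@[route_item "route-SmoothPoincare4-TwistorDissolution", crux]
def SelfDualBlowUp : Prop :=
  ∀ (M : Type) [TopologicalSpace M] [T2Space M] [SecondCountableTopology M] [ChartedSpace (EuclideanSpace ℝ (Fin 4)) M] [IsManifold (𝓡 4) ∞ M], Nonempty (M ≃ₕ (Metric.sphere (0 : EuclideanSpace ℝ (Fin 5)) 1)) → ∃ (n : ℕ) (_ : n ≤ 4) (P : ℕ → Type) (_ : ∀ i, TopologicalSpace (P i)) (_ : ∀ i, T2Space (P i)) (_ : ∀ i, SecondCountableTopology (P i)) (_ : ∀ i, ChartedSpace (EuclideanSpace ℝ (Fin 4)) (P i)) (_ : ∀ i, IsManifold (𝓡 4) ∞ (P i)) (_ : ∀ i, CompactSpace (P i)), Nonempty (P 0 ≃ₘ⟮𝓡 4, 𝓡 4⟯ M) ∧ (∀ i < n, Literature.Topology.FourManifolds.IsConnectedSum (𝓡 4) (𝓡 4) (𝓡 4) (P i) Literature.Topology.FourManifolds.ComplexProjectivePlane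 (P (i + 1))) ∧ ∃ (o : Literature.Topology.FourManifolds.SmoothOrientation (𝓡 4) (P n)) (g : Literature.Geometry.Lorentzian.PseudoRiemannianMetric (𝓡 4) ∞ (EuclideanSpace ℝ (Fin 4)) (TangentSpace (𝓡 4) : P n → Type _)) (_ : g.HasLeviCivita), g.IsRiemannian ∧ (∀ x, 0 < g.scalarCurvature x) ∧ ∀ (x : P n) (e : Fin 4 → TangentSpace (𝓡 4) x), g.IsOrthonormalFrame x e → o.IsPosFrame x (fun i => e (Fin.cast finrank_euclideanSpace_fin i)) → g.blockC g.leviCivita x e = ((g.blockC g.leviCivita x e).trace / 3) • (1 : Matrix (Fin 3) (Fin 3) ℝ)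

-- earlier CP2Cancellation (stmt-SmoothPoincare4-7200, replaced 2026-08-15T16:52:47Z -> stmt-SmoothPoincare4-11126): retired by None — ∀ (S : Literature.Topology.FourManifolds.HomotopySphere 4) (n : ℕ), n ≤ 4 → ∀ (P Q : ℕ → Type) [∀ i, TopologicalSpace (P i)] [∀ i, T2Space (P i)] [∀ i, SecondCountableTopology (P i)] [∀ i, ChartedSpace (EuclideanSpace ℝ (Fin 4)) (P i)] [∀ i, IsManifold (𝓡 4) ∞ (P i)] 
/-- item stmt-SmoothPoincare4-11126 · crux · rank 4 · open · by planner
why it might fail: It is SPC4 for CP²-dissolvable spheres ⊇ all Gluck twists (Σ_K # CP² ≅ CP², tree fact gluckTwist_connectedSum_complexProjectivePlane_holds): one exotic Gluck twist kills it, and the light-bulb isotopy engine stops at odd-Euler duals (Gabai arXiv:1705.09989 Lem 2.3).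
sources: Kirby1997, book:gordon1984-four-manifold-theory, arXiv:1705.09989, GompfStipsicz1999, ManolescuMarengonSarkarWillis2023
(CANCEL≤4; card item CANCELₙ) for a homotopy 4-sphere M (≃ₕ S⁴), n ≤ 4, a chain P₀ ≅ M, P_{i+1} =
P_i # CP² and a chain Q₀ ≅ S⁴, Q_{i+1} = Q_i # CP² (i < n) of closed smooth 4-manifolds: P_n ≅ Q_n ⇒
M ≅ S⁴. At n = 1 this is Melvin's form of the smooth Kirby Problem 4.23 (a degree-one 2-sphere in
CP² with simply connected complement is standard; book:gordon1984-four-manifold-theory p.465); the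
tree's IsConnectedSum being orientation-free, mixed patterns Σ # kCP² # lCP²bar are included — every
case follows from SPC4, and the assembly consumes only the pattern SelfDualBlowUp produces.
[difficulty: open-problem] [restated 2026-08-15 cone-repair: quantified over a bare homotopy
4-sphere M — Hausdorff, second countable, smooth, Nonempty (M ≃ₕ S⁴) — instead of the packaging
structure `HomotopySphere 4`, so the route no longer imports
Literature.Topology.FourManifolds.HomotopySpheres (+ Cobordism) and their undischarged facts;
mathematically identical (compactness/orientability of M are proved tree facts and are not
hypotheses here).] -/
@[route_item "route-SmoothPoincare4-TwistorDissolution", crux]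
def CP2Cancellation : Prop :=
  ∀ (M : Type) [TopologicalSpace M] [T2Space M] [SecondCountableTopology M] [ChartedSpace (EuclideanSpace ℝ (Fin 4)) M] [IsManifold (𝓡 4) ∞ M], Nonempty (M ≃ₕ (Metric.sphere (0 : EuclideanSpace ℝ (Fin 5)) 1)) → ∀ (n : ℕ), n ≤ 4 → ∀ (P Q : ℕ → Type) [∀ i, TopologicalSpace (P i)] [∀ i, T2Space (P i)] [∀ i, SecondCountableTopology (P i)] [∀ i, ChartedSpace (EuclideanSpace ℝ (Fin 4)) (P i)] [∀ i, IsManifold (𝓡 4) ∞ (P i)] [∀ i, CompactSpace (P i)] [∀ i, TopologicalSpace (Q i)] [∀ i, T2Space (Q i)] [∀ i, SecondCountableTopology (Q i)] [∀ i, ChartedSpace (EuclideanSpace ℝ (Fin 4)) (Q i)] [∀ i, IsManifold (𝓡 4) ∞ (Q i)] [∀ i, CompactSpace (Q i)], Nonempty (P 0 ≃ₘ⟮𝓡 4, 𝓡 4⟯ M) → Nonempty (Q 0 ≃ₘ⟮𝓡 4, 𝓡 4⟯ (Metric.sphere (0 : EuclideanSpace ℝ (Fin 5)) 1)) → (∀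 i < n, Literature.Topology.FourManifolds.IsConnectedSum (𝓡 4) (𝓡 4) (𝓡 4) (P i) Literature.Topology.FourManifolds.ComplexProjectivePlane (P (i + 1))) → (∀ i < n, Literature.Topology.FourManifolds.IsConnectedSum (𝓡 4) (𝓡 4) (𝓡 4) (Q i) Literature.Topology.FourManifolds.ComplexProjectivePlane (Q (i + 1))) → Nonempty (P n ≃ₘ⟮𝓡 4, 𝓡 4⟯ Q n) → Nonempty (M ≃ₘ⟮𝓡 4, 𝓡 4⟯ (Metric.sphere (0 : EuclideanSpace ℝ (Fin 5)) 1))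

-- earlier DissolveOfSelfDual (stmt-SmoothPoincare4-7201, replaced 2026-08-15T16:52:47Z -> stmt-SmoothPoincare4-11127): retired by None — PedersenPoonRigidity → SelfDualBlowUp → ∀ (S : Literature.Topology.FourManifolds.HomotopySphere 4), ∃ (n : ℕ) (_ : n ≤ 4) (P Q : ℕ → Type) (_ : ∀ i, TopologicalSpace (P i)) (_ : ∀ i, T2Space (P i)) (_ : ∀ i, SecondCountableTopology (P i)) (_ : ∀ i, ChartedSpace (Eu
/-- item stmt-SmoothPoincare4-11127 · support · rank 9 · open · by planner
sources: PedersenPoon1994, ManolescuMarengonSarkarWillis2023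
glue, provable now (theorem dissolveOfSelfDual_holds in the repair planner's Sketch.lean,
sorry-free, pure logic): PedersenPoonRigidity → SelfDualBlowUp → DISSOLVE≤4 (every homotopy 4-sphere
has n ≤ 4 and chains P from Σ, Q from S⁴ of n projective planes with P_n ≅ Q_n). Materialises the
CP²-dissolution statement (the shape of ManolescuMarengonSarkarWillis2023 Question 9.12) as a decl
that other cards (odd-light-bulb-cp2, cp2-split-taubes-dissolution) can want. [difficulty:
provable-now] [restated 2026-08-15 cone-repair: quantified over a bare homotopy 4-sphere M —
Hausdorff, second countable, smooth, Nonempty (M ≃ₕ S⁴) — instead of the packaging structure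
`HomotopySphere 4`, so the route no longer imports Literature.Topology.FourManifolds.HomotopySpheres
(+ Cobordism) and their undischarged facts; mathematically identical (compactness/orientability of M
are proved tree facts and are not hypotheses here).] -/
@[route_item "route-SmoothPoincare4-TwistorDissolution"]
def DissolveOfSelfDual : Prop :=
  PedersenPoonRigidity → SelfDualBlowUp → ∀ (M : Type) [TopologicalSpace M] [T2Space M] [SecondCountableTopology M] [ChartedSpace (EuclideanSpace ℝ (Fin 4)) M] [IsManifold (𝓡 4) ∞ M], Nonempty (M ≃ₕ (Metric.sphere (0 : EuclideanSpace ℝ (Fin 5)) 1)) → ∃ (n : ℕ) (_ : n ≤ 4) (P Q : ℕ → Type) (_ : ∀ i, TopologicalSpace (P i)) (_ : ∀ i, T2Space (P i)) (_ : ∀ i, SecondCountableTopology (P i)) (_ : ∀ i, ChartedSpace (EuclideanSpace ℝ (Fin 4)) (P i)) (_ : ∀ i, IsManifold (𝓡 4) ∞ (P i)) (_ : ∀ i, CompactSpace (P i)) (_ : ∀ i, TopologicalSpace (Q i)) (_ : ∀ i, T2Space (Q i)) (_ : ∀ i, SecondCountableTopology (Q i)) (_ : ∀ i, ChartedSpace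 (EuclideanSpace ℝ (Fin 4)) (Q i)) (_ : ∀ i, IsManifold (𝓡 4) ∞ (Q i)) (_ : ∀ i, CompactSpace (Q i)), Nonempty (P 0 ≃ₘ⟮𝓡 4, 𝓡 4⟯ M) ∧ Nonempty (Q 0 ≃ₘ⟮𝓡 4, 𝓡 4⟯ (Metric.sphere (0 : EuclideanSpace ℝ (Fin 5)) 1)) ∧ (∀ i < n, Literature.Topology.FourManifolds.IsConnectedSum (𝓡 4) (𝓡 4) (𝓡 4) (P i) Literature.Topology.FourManifolds.ComplexProjectivePlane (P (i + 1))) ∧ (∀ i < n, Literature.Topology.FourManifolds.IsConnectedSum (𝓡 4) (𝓡 4) (𝓡 4) (Q i) Literature.Topology.FourManifolds.ComplexProjectivePlane (Q (i + 1))) ∧ Nonempty (P n ≃ₘ⟮𝓡 4, 𝓡 4⟯ Q n)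

/-- item stmt-SmoothPoincare4-7202 · assembly · rank 1 · open · by planner
sources: PedersenPoon1994, HatcherAT2002, LeeSmoothManifolds2013
[assembly] PedersenPoonRigidity → SelfDualBlowUp → CP2Cancellation → SmoothPoincare4 (the
sub-problem statement `SmoothPoincare4 = Literature.SPC4.SmoothPoincareConjectureFour`). -/
@[route_item "route-SmoothPoincare4-TwistorDissolution"]
def Assembly : Prop :=
  PedersenPoonRigidity → SelfDualBlowUp → CP2Cancellation → SmoothPoincare4

/-! D-0027 §2.1 — DECIDING THEOREM (planner-authored via `route open/edit --closes-file`; by planner-rrepair-SmoothPoincare4-TwistorDissolu-32a67a82-0 2026-08-15T16:52:47Z):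
its hypotheses are this route's items and its conclusion the sub-problem Statement (glue_lint), and it elaborates with this file. -/

@[closes "route-SmoothPoincare4-TwistorDissolution"] theorem closes (hR : PedersenPoonRigidity) (hE : SelfDualBlowUp) (hC : CP2Cancellation) :
    _root_.SmoothPoincare4 := by
  intro M _ _ _ _ _ e
  obtain ⟨n, hn, P, iT, iH, iS, iC, iM, iK, hP0, hP, o, g, hg, hRiem, hscal, hSD⟩ := hE M ⟨e⟩
  obtain ⟨Q, qT, qH, qS, qC, qM, qK, hQ0, hQ, hPQ⟩ :=
    hR M ⟨e⟩ n hn P hP0 hP ⟨o, g, hg, hRiem, hscal, hSD⟩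
  exact hC M ⟨e⟩ n hn P Q hP0 hQ0 hP hQ hPQ

end Summit.SmoothPoincare4.SmoothPoincare4.Theses.TwistorDissolution
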